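import Mathlib
import HarnessLib
import Summits.ValiantsHypothesis.ValiantsHypothesis.Theses.MonotoneRestoration
import Literature.Computability.AlgebraicComplexity.ArithCircuit
import Literature.Computability.AlgebraicComplexity.ArithCircuitProofs
import Literature.Computability.AlgebraicComplexity.MonotoneStructure
import Literature.Computability.AlgebraicComplexity.PermanentIrreducible
import Literature.ModelTheory.FiniteModelTheory.CkEquiv
import Summits.ValiantsHypothesis.ValiantsHypothesis.Theorems.MonotoneRestorationMonotoneRestorationQPCosetCount
import Summits.ValiantsHypothesis.ValiantsHypothesis.Theorems.MonotoneRestorationMonotoneRestorationQPSymmetricLB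
import Summits.ValiantsHypothesis.ValiantsHypothesis.Theorems.MonotoneRestorationMonotoneRestorationQPSupportSymmetrisation
import Summits.ValiantsHypothesis.ValiantsHypothesis.Theorems.MonotoneRestorationMonotoneRestorationQPSparseRegime
import Summits.ValiantsHypothesis.ValiantsHypothesis.Theorems.MonotoneRestorationMonotoneRestorationQPBeta
import Literature.Computability.AlgebraicComplexity.SymmetricArithCircuit
import Literature.Computability.AlgebraicComplexity.DawarWilsenach2025Proofs
import Literature.GroupTheory.PermutationGroups.SmallIndexSubgroups
import Summits.ValiantsHypothesis.ValiantsHypothesis.Theorems.MonotoneRestorationQP.Negative.LoadBearing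
import Summits.ValiantsHypothesis.ValiantsHypothesis.Theorems.MonotoneRestorationMonotoneRestorationQPPermSupportCount

/-! TTRL-lite variant V19395 of stmt-ValiantsHypothesis-15886 -/

set_option linter.dupNamespace false

namespace Summit.ValiantsHypothesis.ValiantsHypothesis.Theorems

open Summit.ValiantsHypothesis.ValiantsHypothesis.Theses.MonotoneRestoration
open Literature.Computability.AlgebraicComplexity

/-- TTRL-lite variant V19395 (`lemma_proposal`) of the registered stub `stub_gammaArithmetic` of
`stmt-ValiantsHypothesis-15886`: the binomial conjunct of the `γ`-arithmetic is never binding —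
whenever `4 (m + 2) ≤ n` one has `2 ^ m < C(n, m + 2)`.  Proof: `C(n, m+2) ≥ centralBinom (m+2)`
(monotonicity in `n`, as `2 (m + 2) ≤ n`) and `4 ^ (m+2) ≤ 2 (m+2) · centralBinom (m+2)`, while
`16 · 2 ^ m > 2 (m + 2)`. -/
theorem stub_gammaArithmetic_var19395 :
    ∀ (n m : ℕ), 4 * (m + 2) ≤ n → 2 ^ m < n.choose (m + 2) := by
  intro n m hn
  have h2k : 2 * (m + 2) ≤ n := le_trans (Nat.mul_le_mul_right _ (by norm_num)) hn
  have hX : 0 < 2 ^ m := Nat.two_pow_pos m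
  have hlt : m + 2 < 2 ^ (m + 2) := Nat.lt_two_pow_self
  have h4 : 4 ^ (m + 2) ≤ 2 * (m + 2) * Nat.centralBinom (m + 2) :=
    Nat.four_pow_le_two_mul_self_mul_centralBinom (m + 2) (by omega)
  have hcb : Nat.centralBinom (m + 2) ≤ n.choose (m + 2) := by
    rw [Nat.centralBinom_eq_two_mul_choose]
    exact Nat.choose_le_choose (m + 2) h2k
  by_contra hle
  push Not at hle
  have h1 : 4 ^ (m + 2) ≤ 2 * (m + 2) * 2 ^ m :=
    h4.trans (Nat.mul_le_mul_left _ (hcb.trans hle))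
  have e1 : 4 ^ (m + 2) = (2 ^ m * 16) * 2 ^ m := by
    rw [show (4 : ℕ) = 2 * 2 from rfl, mul_pow]; ring
  rw [e1] at h1
  have h3 : 2 ^ m * 16 ≤ 2 * (m + 2) := Nat.le_of_mul_le_mul_right h1 hX
  rw [pow_add] at hlt
  norm_num at hlt
  omega

end Summit.ValiantsHypothesis.ValiantsHypothesis.Theorems
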